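import Literature.Geometry.Riemannian.ShrinkerEntropyProofs
import Literature.Geometry.Riemannian.ShrinkerScalarCurvatureNonnegHolds
import Literature.Geometry.Riemannian.ShrinkerPotentialGrowthProofs
import Summits.SmoothPoincare4.SmoothPoincare4.Theorems.EntropyRungNoncompactShrinkerGapStubCompactSupportLSIMixture
import HarnessLib

/-!
# Helper `helper_carrilloNi_clauses_i_iii` of line `collapsed-ends-usc` (crux
# `EntropyRung.NoncompactShrinkerGap`, stmt-SmoothPoincare4-10868): Carrillo–Ni 2009, Thm. 1.1 (i),
# the sharpness clause (iii), and `μ(g, 1) ≤ log Θ` — UNCONDITIONALLY on every complete gradient shrinker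

On a complete connected gradient shrinking Ricci soliton `(Mⁿ, g, f)` of any dimension
(`Ric + Hess f = g/2`, normalised by `R + |∇f|² = f`, closed `g`-balls compact), with
`Θ = (4π)^{-n/2} ∫ e^{-f} dV`:
* (i) `e^{-f} ∈ L¹(dV)` and the shift `f + log Θ` is compatible (`∫ (4π)^{-n/2} e^{-(f + log Θ)} = 1`);
* (iii) `𝒲(g, f + log Θ, 1) = log Θ`;
* `μ(g, 1) ≤ log Θ`.
This is VERBATIM the conclusion of the tree's
`CarrilloNi2009_shrinkerLSI.clauses_i_iii_of_proper` (`ShrinkerEntropyProofs.lean`), whose two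
extra inputs are theorems of the tree:
* `R ≥ 0` on every complete connected gradient shrinker — Zhang 2009 / Chen 2009 / Haslhofer–Müller
  (2.6), DISCHARGED as `shrinkerScalarCurvature_nonneg_holds` (`ShrinkerScalarCurvatureNonnegHolds.lean`);
* properness of `f` — from `R ≥ 0`: a minimum point `p` of `f` and the lower quadratic growth
  `¼(d(p, x) − 5n)₊² ≤ f(x)` (Haslhofer–Müller 2011, Lemma 2.1:
  `HaslhoferMuller.exists_forall_potential_le`, `HaslhoferMuller.potential_lower_of_scalarCurvature_nonneg`,
  `ShrinkerPotentialGrowthProofs.lean`; the regularity instances of the smooth Levi-Civita connection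
  from `isLocallyContMDiff_leviCivita_holds`), whence `{f ≤ R}` is compact
  (`NoncompactShrinkerGapCompactSupportLSI.isCompact_sublevel_of_growth`).
Two documented entry points ride along: `carrilloNi_integrable_exp_neg` (clause (i) alone) and
`carrilloNi_muEntropy_le_log` (`μ(g, 1) ≤ log Θ` alone). Everything here is proved; no definition
and no named fact is introduced.

## References

* [CarrilloNi2009] J. Carrillo, L. Ni, Comm. Anal. Geom. 17 (2009) 721–753, Thm. 1.1 (i), §4, Cor. 4.1.
* [HaslhoferMuller2011] R. Haslhofer, R. Müller, GAFA 21 (2011) 1091–1116, §2 (2.6), Lemma 2.1.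
* [Zhang2009] Z.-H. Zhang, Proc. AMS 137 (2009) 2755–2759, Thm. 1.3 (ii).
-/

noncomputable section

-- `Summit.SmoothPoincare4.SmoothPoincare4.…` (summit = problem) trips `dupNamespace` on every decl.
set_option linter.dupNamespace false

open scoped Manifold ContDiff ENNReal NNReal Topology
open MeasureTheory Set Filter
open Literature.Geometry.Lorentzian Literature.Geometry.Riemannian

namespace Summit.SmoothPoincare4.SmoothPoincare4.Theorems.NoncompactShrinkerGapCarrilloNiClauses

open Summit.SmoothPoincare4.SmoothPoincare4.Theorems.NoncompactShrinkerGapCompactSupportLSI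

/-! ## Properness of the potential (any dimension) -/

section Shrinker

variable {n : ℕ} {M : Type} [TopologicalSpace M] [T2Space M] [SecondCountableTopology M]
  [ChartedSpace (EuclideanSpace ℝ (Fin n)) M] [IsManifold (𝓡 n) ∞ M] [ConnectedSpace M]
  [T3Space M] [MeasurableSpace M] [BorelSpace M]

/-- **The potential of a complete gradient shrinker is proper, and `R ≥ 0`** (Haslhofer–Müller
2011, (2.6) and Lemma 2.1), any dimension `n`: on a complete connected gradient shrinker
normalised by `R + |∇f|² = f`, `R ≥ 0` (`shrinkerScalarCurvature_nonneg_holds`), `M` is nonempty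
(a minimum point `p` of `f`, `HaslhoferMuller.exists_forall_potential_le`), and every sub-level set
`{f ≤ R}` is compact — by the lower growth `¼(d(p, ·) − 5n)₊² ≤ f`
(`HaslhoferMuller.potential_lower_of_scalarCurvature_nonneg`) and
`isCompact_sublevel_of_growth`. [cite: HaslhoferMuller2011, §2 (2.6) and Lemma 2.1 (p. 5)] -/
theorem scalarCurvature_nonneg_and_isCompact_sublevel
    (g : PseudoRiemannianMetric (𝓡 n) ∞ (EuclideanSpace ℝ (Fin n)) (TangentSpace (𝓡 n) : M → Type _))
    [g.HasLeviCivita] (f : M → ℝ) (hg : g.IsRiemannian)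
    (hc : ∀ (x : M) (r : NNReal), IsCompact {y : M | g.edist hg x y ≤ r})
    (hf : ContMDiff (𝓡 n) 𝓘(ℝ, ℝ) ∞ f)
    (hsol : ∀ (x : M) (X Y : TangentSpace (𝓡 n) x),
      g.ricci x X Y + g.hessian f x X Y = (1 / 2 : ℝ) * g.val x X Y)
    (hnorm : ∀ x : M, g.scalarCurvature x + g.gradSq f x = f x) :
    (∀ x : M, 0 ≤ g.scalarCurvature x) ∧ Nonempty M ∧ ∀ R : ℝ, IsCompact {x | f x ≤ R} := by
  classical
  -- adapted from `CollapsedEndsUsc.integrable_exp_neg_of_nonneg` (line skeleton v8)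
  have hS0 : ∀ x, 0 ≤ g.scalarCurvature x :=
    shrinkerScalarCurvature_nonneg_holds n M g f hg hc hf hsol hnorm
  have hk1 : ((1 : ℕ∞) : ℕ∞ω) + 1 ≤ (∞ : ℕ∞ω) := by
    rw [show ((1 : ℕ∞) : ℕ∞ω) + 1 = 2 by norm_num]
    exact WithTop.coe_le_coe.2 le_top
  haveI : CovariantDerivative.ContMDiffCovariantDerivative g.leviCivita 1 :=
    ⟨g.isLocallyContMDiff_leviCivita_holds 1 hk1 univ isOpen_univ⟩
  haveI : CovariantDerivative.ContMDiffCovariantDerivative g.leviCivita ∞ :=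
    ⟨g.isLocallyContMDiff_leviCivita_holds ⊤ (le_of_eq rfl) univ isOpen_univ⟩
  have hgrad : ∀ x, g.gradSq f x ≤ f x := fun x ↦ by linarith [hS0 x, hnorm x]
  obtain ⟨p, hp⟩ := HaslhoferMuller.exists_forall_potential_le g hg hc hf hgrad hsol
  have hlow : ∀ (x : M) (r : NNReal), (r : ℝ≥0∞) ≤ g.edist hg p x →
      (1 / 4 : ℝ) * (max ((r : ℝ) - 5 * n) 0) ^ 2 ≤ f x := fun x r hr ↦ by
    have h := HaslhoferMuller.potential_lower_of_scalarCurvature_nonneg g hg hc hf hsol hnorm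
      hS0 hp x r hr
    rwa [finrank_euclideanSpace_fin] at h
  exact ⟨hS0, ⟨p⟩, isCompact_sublevel_of_growth hg hf.continuous hc hlow⟩

/-- **Carrillo–Ni 2009, Thm. 1.1 (i), (iii) and `μ(g, 1) ≤ log Θ`, unconditionally** (any
dimension `n`, explicit hypotheses): on a complete connected normalised gradient shrinker,
`e^{-f} ∈ L¹`, the shift `f + log Θ` is compatible, `𝒲(g, f + log Θ, 1) = log Θ`, and
`μ(g, 1) ≤ log Θ`, where `Θ = (4π)^{-n/2} ∫ e^{-f} dV`. Proof: `R ≥ 0` and properness of `f`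
(`scalarCurvature_nonneg_and_isCompact_sublevel`), then
`CarrilloNi2009_shrinkerLSI.clauses_i_iii_of_proper` with `B = 0`.
[cite: CarrilloNi2009, Thm. 1.1 (i), §4 and Cor. 4.1] -/
theorem clauses_i_iii
    (g : PseudoRiemannianMetric (𝓡 n) ∞ (EuclideanSpace ℝ (Fin n)) (TangentSpace (𝓡 n) : M → Type _))
    [g.HasLeviCivita] (f : M → ℝ) (hg : g.IsRiemannian)
    (hc : ∀ (x : M) (r : NNReal), IsCompact {y : M | g.edist hg x y ≤ r})
    (hf : ContMDiff (𝓡 n) 𝓘(ℝ, ℝ) ∞ f)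
    (hsol : ∀ (x : M) (X Y : TangentSpace (𝓡 n) x),
      g.ricci x X Y + g.hessian f x X Y = (1 / 2 : ℝ) * g.val x X Y)
    (hnorm : ∀ x : M, g.scalarCurvature x + g.gradSq f x = f x) :
    Integrable (fun x ↦ Real.exp (-f x)) g.riemVolume ∧
    g.IsEntropyCompatible (fun y ↦ f y +
        Real.log ((4 * Real.pi) ^ (-(n : ℝ) / 2) * ∫ x, Real.exp (-f x) ∂g.riemVolume)) 1 ∧
    g.wEntropy g.leviCivita (fun y ↦ f y +
        Real.log ((4 * Real.pi) ^ (-(n : ℝ) / 2) * ∫ x, Real.exp (-f x) ∂g.riemVolume)) 1 =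
      Real.log ((4 * Real.pi) ^ (-(n : ℝ) / 2) * ∫ x, Real.exp (-f x) ∂g.riemVolume) ∧
    g.muEntropy g.leviCivita 1 ≤
      ((Real.log ((4 * Real.pi) ^ (-(n : ℝ) / 2) * ∫ x, Real.exp (-f x) ∂g.riemVolume) : ℝ) :
        EReal) := by
  obtain ⟨hS0, hne, hprop⟩ := scalarCurvature_nonneg_and_isCompact_sublevel g f hg hc hf hsol hnorm
  exact CarrilloNi2009_shrinkerLSI.clauses_i_iii_of_proper hg hf hsol hnorm hprop (B := 0)
    (fun x ↦ by rw [neg_zero]; exact hS0 x)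

end Shrinker

/-! ## The registered helper -/

/-- **Helper `helper_carrilloNi_clauses_i_iii` of line `collapsed-ends-usc`** — Carrillo–Ni 2009,
Thm. 1.1 (i) (`e^{-f} ∈ L¹` and the shift `f + log Θ` is compatible), the sharpness clause (iii)
`𝒲(g, f + log Θ, 1) = log Θ`, and `μ(g, 1) ≤ log Θ`, UNCONDITIONALLY on every complete connected
normalised gradient shrinker of every dimension (`Θ = (4π)^{-n/2} ∫ e^{-f} dV`): the conclusion of
`CarrilloNi2009_shrinkerLSI.clauses_i_iii_of_proper`, its inputs `R ≥ 0`
(`shrinkerScalarCurvature_nonneg_holds`) and properness of `f` (Haslhofer–Müller's Lemma 2.1,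
`isCompact_sublevel_of_growth`) being theorems (`clauses_i_iii`).
[cite: CarrilloNi2009, Thm. 1.1 (i), §4 and Cor. 4.1] -/
theorem helper_carrilloNi_clauses_i_iii : ∀ (n : ℕ) (M : Type) [TopologicalSpace M] [T2Space M] [SecondCountableTopology M] [ChartedSpace (EuclideanSpace ℝ (Fin n)) M] [IsManifold (𝓡 n) ∞ M] [ConnectedSpace M] [T3Space M] [MeasurableSpace M] [BorelSpace M] (g : PseudoRiemannianMetric (𝓡 n) ∞ (EuclideanSpace ℝ (Fin n)) (TangentSpace (𝓡 n) : M → Type _)) [g.HasLeviCivita] (f : M → ℝ) (hg : g.IsRiemannian), (∀ (x : M) (r : NNReal), IsCompact {y : M | g.edist hg x y ≤ r}) → ContMDiff (𝓡 n) 𝓘(ℝ, ℝ) ∞ f → (∀ (x : M) (X Y : TangentSpace (𝓡 n) x), g.ricci x X Y + g.hessian f x X Y = (1 / 2 : ℝ) * g.val x X Y) → (∀ x : M, g.scalarCurvature x + g.gradSq f x = f x) → Integrable (fun x ↦ Real.exp (-f x)) g.riemVolume ∧ g.IsEntropyCompatible (fun y ↦ f y + Real.log ((4 * Real.pi) ^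 (-(n : ℝ) / 2) * ∫ x, Real.exp (-f x) ∂g.riemVolume)) 1 ∧ g.wEntropy g.leviCivita (fun y ↦ f y + Real.log ((4 * Real.pi) ^ (-(n : ℝ) / 2) * ∫ x, Real.exp (-f x) ∂g.riemVolume)) 1 = Real.log ((4 * Real.pi) ^ (-(n : ℝ) / 2) * ∫ x, Real.exp (-f x) ∂g.riemVolume) ∧ g.muEntropy g.leviCivita 1 ≤ ((Real.log ((4 * Real.pi) ^ (-(n : ℝ) / 2) * ∫ x, Real.exp (-f x) ∂g.riemVolume) : ℝ) : EReal) :=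
  fun _ _ _ _ _ _ _ _ _ _ _ g _ f hg hc hf hsol hnorm ↦ clauses_i_iii g f hg hc hf hsol hnorm

/-! ## Entry points: clause (i) alone, and `μ(g, 1) ≤ log Θ` alone -/

section Corollaries

variable {n : ℕ} {M : Type} [TopologicalSpace M] [T2Space M] [SecondCountableTopology M]
  [ChartedSpace (EuclideanSpace ℝ (Fin n)) M] [IsManifold (𝓡 n) ∞ M] [ConnectedSpace M]
  [T3Space M] [MeasurableSpace M] [BorelSpace M]

/-- **Carrillo–Ni 2009, Thm. 1.1 (i), unconditionally** (any dimension `n`): on a complete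
connected gradient shrinker `Ric + Hess f = g/2` normalised by `R + |∇f|² = f` (closed `g`-balls
compact), `e^{-f}` is integrable against the Riemannian volume. [cite: CarrilloNi2009, Thm. 1.1 (i)] -/
theorem carrilloNi_integrable_exp_neg
    (g : PseudoRiemannianMetric (𝓡 n) ∞ (EuclideanSpace ℝ (Fin n)) (TangentSpace (𝓡 n) : M → Type _))
    [g.HasLeviCivita] (f : M → ℝ) (hg : g.IsRiemannian)
    (hc : ∀ (x : M) (r : NNReal), IsCompact {y : M | g.edist hg x y ≤ r})
    (hf : ContMDiff (𝓡 n) 𝓘(ℝ, ℝ) ∞ f)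
    (hsol : ∀ (x : M) (X Y : TangentSpace (𝓡 n) x),
      g.ricci x X Y + g.hessian f x X Y = (1 / 2 : ℝ) * g.val x X Y)
    (hnorm : ∀ x : M, g.scalarCurvature x + g.gradSq f x = f x) :
    Integrable (fun x ↦ Real.exp (-f x)) g.riemVolume :=
  (clauses_i_iii g f hg hc hf hsol hnorm).1

/-- **`μ(g, 1) ≤ log Θ`, unconditionally** (Carrillo–Ni 2009, §4 / Cor. 4.1; any dimension `n`):
on a complete connected normalised gradient shrinker the `μ`-entropy at scale `1` is at most
`log((4π)^{-n/2} ∫ e^{-f} dV)` (the shift `f + log Θ` is an admissible competitor with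
`𝒲 = log Θ`). [cite: CarrilloNi2009, §4 and Cor. 4.1] -/
theorem carrilloNi_muEntropy_le_log
    (g : PseudoRiemannianMetric (𝓡 n) ∞ (EuclideanSpace ℝ (Fin n)) (TangentSpace (𝓡 n) : M → Type _))
    [g.HasLeviCivita] (f : M → ℝ) (hg : g.IsRiemannian)
    (hc : ∀ (x : M) (r : NNReal), IsCompact {y : M | g.edist hg x y ≤ r})
    (hf : ContMDiff (𝓡 n) 𝓘(ℝ, ℝ) ∞ f)
    (hsol : ∀ (x : M) (X Y : TangentSpace (𝓡 n) x),
      g.ricci x X Y + g.hessian f x X Y = (1 / 2 : ℝ) * g.val x X Y)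
    (hnorm : ∀ x : M, g.scalarCurvature x + g.gradSq f x = f x) :
    g.muEntropy g.leviCivita 1 ≤
      ((Real.log ((4 * Real.pi) ^ (-(n : ℝ) / 2) * ∫ x, Real.exp (-f x) ∂g.riemVolume) : ℝ) :
        EReal) :=
  (clauses_i_iii g f hg hc hf hsol hnorm).2.2.2

end Corollaries

end Summit.SmoothPoincare4.SmoothPoincare4.Theorems.NoncompactShrinkerGapCarrilloNiClauses

end
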